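import Summits.ResolutionOfSingularities.ResolutionOfSingularities.Theorems.HilbertSamuelEliminationSigmaMaxModificationsCorridor3WLadderSegmentsAssemblyAF
import Summits.ResolutionOfSingularities.ResolutionOfSingularities.Theorems.HilbertSamuelEliminationSigmaMaxModificationsCorridor3WLadderSegmentsAssemblyB
import Summits.ResolutionOfSingularities.ResolutionOfSingularities.Theorems.HilbertSamuelEliminationSigmaMaxModificationsCorridor3WLadderRecognitionNearLocusGeomDir
import Summits.ResolutionOfSingularities.ResolutionOfSingularities.Theorems.HilbertSamuelEliminationSigmaMaxModificationsCorridor3WLadderMovingTwoLocDefs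
import HarnessLib

/-!
# [OURS · L1 W4.2] RECOGNITION ASSEMBLY, STEP B, KEYED ON A POINT HYPOTHESIS `F`, AND THE `p = 2` / `Q`-GENERIC PURE-GEOMETRY ROW
# `Seg.UnitGeometryAtQM p Q` FROM THE GEOMETRIC-DIRECTRIX FORMS OF THE PRINTED FACTS (division (c′) of res-L1-w42-plan-1 RULING v3.14-24 (GD);
# crux `SigmaMaxModifications` stmt-ResolutionOfSingularities-18506; conjunct `SigmaMaxModificationsCorridor3` stmt-…-19249; line `w_ladder`)

Pool seat res-D-pv-038 (gen 8). Helper file `--supports stmt-ResolutionOfSingularities-19249 --as helper`; kernel only, no new definition.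

§1 is res-L1-w42-stub-1's Step B (`…SegmentsAssemblyB`: clauses (iv), (v) of Def. 6.38 on `unitTowerU` from res-L1-w42-stub-2's unit-level geometry)
VERBATIM with `hchar : CharHypothesis` ↦ `hF` (an arbitrary point hypothesis `F` along the near loci of `locTower b`) and the (F1)-keyed printed
binders ↦ the same statements keyed on `F` (section variables `h314f`, `hPb`, `h314`, `h314pt`; one-step geometry `BlowupTowerNearW.*`).
§2 instantiates `F := GeomDirHypothesis`: along the near loci of `locTower b` it HOLDS at `N = 3` from `ē(x_b) ≤ 2`
(`BlowupTowerNearGeomDir.geomDirHypothesis_of_mem_nearLocus`, res-L1-w42-stub-2), and the binders are the printed geometric-directrix forms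
`Theorem314_nearFibre_geomDir` (near-fibre form of Thm. 3.14 ♯), `Moving.isIso_residueFieldMap_of_near_of_geomDirHypothesis` ((B4♯), from
`Thm314_point_locus_geomDir`, res-L1-w42-stub-4), `Theorem314_geomDir`, `Thm314_point_locus_geomDir` — giving **`Seg.unitGeometryAtQM_of_geomDirFacts :
UnitGeometryAtQM p Q` for EVERY `p` and EVERY regime `Q`** (in particular the β row `p = 2`, `Q = ⊤` of res-L1-w42-stub-3 / res-L1-w42-stub-4's census),
hence `UnitRecognitionAtQMU p Q` by res-L1-w42-stub-1's `unitRecognitionAtQMU_of_geometry`, hence the characteristic-free extraction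
`UnitTowerExtractionLocFreeM p` (`Seg.unitTowerExtractionLocFreeM_of_geomDirFacts`) — the β census's `hrec`-fed term, now from printed facts.

OURS bookkeeping; NOT a statement of the manuscript [Hironaka2017] nor of [CossartJannsenSaito2020]. AI-written; AI review is weaker than expert
review.

References: V. Cossart, U. Jannsen, S. Saito, LNM 2270 (2020), Thm. 3.14, Lemma 6.33, Def. 6.34, Def. 6.38, p. 103–107 [CossartJannsenSaito2020].
-/

noncomputable section

set_option linter.dupNamespace false -- namespace `…Corridor3.Moving` re-enters `…Corridor3` (module convention of the Moving files)

open CategoryTheory AlgebraicGeometry TopologicalSpace Topology IsLocalRing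
open Literature.AlgebraicGeometry.Resolution Literature.RingTheory.HilbertSamuel
open Literature.AlgebraicGeometry.CossartJannsenSaito2020
open Summit.ResolutionOfSingularities.ResolutionOfSingularities.Theorems.CampaignW42
open Summit.ResolutionOfSingularities.ResolutionOfSingularities.Theorems.SigmaMaxModificationsCorridor3.Helpers

namespace Summit.ResolutionOfSingularities.ResolutionOfSingularities.Theorems.SigmaMaxModificationsCorridor3.Moving.Seg

/-! ## §1. Clauses (iv), (v) of Def. 6.38 on the unit tower, keyed on `F` -/

section AssemblyBF

variable {R : ∀ S : Scheme.{0}, CentreSeq S → Prop} {N : ℕ} {ν : ℕ → ℕ} {k : Type} [Field k]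
  {c : ℕ → MarkedStage.{0}} (hc : ∀ n, CanonicalNearStep R N ν (c n) (c (n + 1))) (hRf : OracleFunctional R) (hRa : OracleAdmissible R)
  (hν : ν ≠ iterPSum N Phi) (h0 : Helpers.CycleInv k N ν (c 0)) (hgen : ∀ n, ∃ m, n ≤ m ∧ (c m).IsBlownUp R N ν)
  (hBG : ∀ n, ∃ m, n ≤ m ∧ (c m).IsBlownUp R N ν ∧ Iso N (c m))
  {p : ℕ} {X : Scheme.{0}} [IsLocallyNoetherian X] {x : X} (hX : IsMaximalOrigin p N ν X x)
  (hreach : Reaches R N ν (MarkedStage.init X x) (c 0))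
  (F : ∀ (X : Scheme.{0}) [IsLocallyNoetherian X], X → Prop)
  (h314f : ∀ (X X' : Scheme.{0}) [IsLocallyNoetherian X] (π : X' ⟶ X) (D : X.IdealSheafData),
    Scheme.IsExcellent X → IdealSheafData.IsPermissible D → IsBlowup π D →
      ∀ N : ℕ, topologicalKrullDim X ≤ (N : WithBot ℕ∞) →
        ∀ x : X, x ∈ D.support → F X x →
          (Scheme.dirDim X x : WithBot ℕ∞) ≤ ringKrullDim (X.presheaf.stalk x ⧸ stalkIdeal D x) + 1 →
            {x' : X' | π.base x' = x ∧ Scheme.hsFun X' N x' = Scheme.hsFun X N x}.Subsingleton)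
  (hPb : ∀ (X X' : Scheme.{0}) [IsLocallyNoetherian X] [IsLocallyNoetherian X'] (π : X' ⟶ X) (D : X.IdealSheafData),
    Scheme.IsExcellent X → IdealSheafData.IsPermissible D → IsBlowup π D →
      ∀ N : ℕ, topologicalKrullDim ↥X ≤ (N : WithBot ℕ∞) →
        ∀ x' : X', π.base x' ∈ D.support → stalkIdeal D (π.base x') = maximalIdeal _ →
          F X (π.base x') → Scheme.dirDim X (π.base x') = 1 →
            Scheme.hsFun X' N x' = Scheme.hsFun X N (π.base x') → IsIso (π.residueFieldMap x'))
  (h314 : ∀ (X X' : Scheme.{0}) [IsLocallyNoetherian X] [IsLocallyNoetherian X'] (π : X' ⟶ X) (D : X.IdealSheafData),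
    Scheme.IsExcellent X → IdealSheafData.IsPermissible D → IsBlowup π D →
      ∀ N : ℕ, topologicalKrullDim X ≤ (N : WithBot ℕ∞) →
        ∀ x' : X', π.base x' ∈ D.support → F X (π.base x') →
          Scheme.hsFun X' N x' = Scheme.hsFun X N (π.base x') →
            ringKrullDim (X.presheaf.stalk (π.base x') ⧸ stalkIdeal D (π.base x')) <
              (Scheme.dirDim X (π.base x') : WithBot ℕ∞))
  (h314pt : ∀ (X X' : Scheme.{0}) [IsLocallyNoetherian X] (π : X' ⟶ X) (x : X) (hx : IsClosed ({x} : Set X)) (N : ℕ)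
    (x' : X'), Scheme.IsExcellent X → IdealSheafData.IsPermissible (Scheme.IdealSheafData.vanishingIdeal ⟨{x}, hx⟩) →
      IsBlowup π (Scheme.IdealSheafData.vanishingIdeal ⟨{x}, hx⟩) → topologicalKrullDim ↥X ≤ (N : WithBot ℕ∞) → π.base x' = x → F X x →
        Scheme.hsFun X' N x' = Scheme.hsFun X N x → IsOnProjDirectrix π x')

include hRf hX hreach h314f hPb h314 h314pt in
/-- **INSIDE THE UNIT THE NEAR POINT IS NOT ISOLATED** in the near locus, keyed on `F` (twin of `Seg.exists_nearPt_not_isolated_unitTowerU`) (the stage is not `Iso`, so the near locus is an infinite irreducible curve).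
[cite: CossartJannsenSaito2020, Def. 6.38 (iii), Rem. 6.29 (1)] -/
theorem exists_nearPt_not_isolated_unitTowerUF (h36 : CossartJannsenSaito2020_thm_3_6.{0}) (h3104 : CossartJannsenSaito2020_thm_3_10_4.{0})
    (b : ℕ) (hb : (c b).IsBlownUp R N ν) (hiso : Iso N (c b))
    (hF : ∀ n, ∀ y ∈ (locTower hc hRa hν h0 b).nearLocus N (basePt hc hRa hν h0 b) n,
      @F ((locTower hc hRa hν h0 b).X n) ((locTower hc hRa hν h0 b).ln n) y)
    (he : dirDim (c b) = 2) (hē : (c b).geomDirDim ≤ 2) (hemp : HEmpU hc hRa hν h0 hgen hBG b) {q : ℕ} (hq1 : 1 ≤ q) (hq : q < unitLen hgen hBG b) :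
    ∃ s ∈ (unitTowerU hc hRa hν h0 hgen hBG b hemp).nearLocus N (basePt hc hRa hν h0 b) q,
      IsClosed ({s} : Set ((unitTowerU hc hRa hν h0 hgen hBG b hemp).X q)) ∧
      ¬ ∃ U : Set ((unitTowerU hc hRa hν h0 hgen hBG b hemp).X q), IsOpen U ∧
        U ∩ (unitTowerU hc hRa hν h0 hgen hBG b hemp).nearLocus N (basePt hc hRa hν h0 b) q = {s} := by
  haveI : IsLocallyNoetherian ((upTower hc hRa hν h0 b).X 0) := (upTower hc hRa hν h0 b).ln 0
  obtain ⟨k', _, _, hg⟩ := hX.exists_stateGood_of_reaches hRa hν (reaches_chain hreach hc b)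
  have hU := stratumIsolated_of_iso hg hiso
  obtain ⟨s, hs, -, hscl⟩ := exists_nearPt_unitTowerU hc hRa hν h0 hgen hBG hX hreach hemp q
  refine ⟨s, hs, hscl, ?_⟩
  -- the chain's near locus at the kept stage is infinite irreducible
  have hn : Seg.relIdxU hgen hBG b q = Seg.relIdx hgen b q := Seg.relIdxU_eq_of_le hgen hBG b hq.le
  have hnotG : ¬ Iso N (c (b + Seg.relIdxU hgen hBG b q)) := by
    rw [hn]; exact Seg.not_G_add_relIdx_of_lt_relLen hgen hBG b hq1 hq
  have hpos : 0 < Seg.relIdxU hgen hBG b q := by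
    rw [hn]
    have := BlowupTower.cidx_strictMono 0 (Seg.relGap hgen b) (Nat.lt_of_lt_of_le Nat.zero_lt_one hq1)
    simpa using this
  have hlt : Seg.relIdxU hgen hBG b q < Seg.relIdxU hgen hBG b (Seg.relLen hgen hBG b) := by
    rw [hn, Seg.relIdxU_eq_of_le hgen hBG b le_rfl]
    exact BlowupTower.cidx_strictMono 0 (Seg.relGap hgen b) hq
  have hDR := dich_regN_of_printedFactsF hc hRf hRa hν h0 hgen hBG hX hreach F h314f hPb h314 h314pt h36 h3104 b hb hiso hF he hē
  obtain ⟨hinf, hirr⟩ := infinite_irreducible_nearLocus_of_not_iso hc hRa hν h0 hX hreach b hU _ hnotG (hDR.1 _ hpos hlt)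
  have hrange : (upTower hc hRa hν h0 b).nearLocus N (c b).pt (Seg.relIdxU hgen hBG b q) ⊆ Set.range (locι hc hRa hν h0 b (Seg.relIdxU hgen hBG b q)).base := by
    have h := BlowupTowerNear.nearLocus_subset_range_bcι (upTower hc hRa hν h0 b)
      (((upTower hc hRa hν h0 b).X 0).fromSpecStalk ((c b).pt : (upTower hc hRa hν h0 b).X 0)) N (basePt hc hRa hν h0 b) (Seg.relIdxU hgen hBG b q)
    rw [show (((upTower hc hRa hν h0 b).X 0).fromSpecStalk ((c b).pt : (upTower hc hRa hν h0 b).X 0)).base (basePt hc hRa hν h0 b) = (c b).pt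
      from Scheme.fromSpecStalk_closedPoint] at h
    exact h
  have hemb : Topology.IsEmbedding (locι hc hRa hν h0 b (Seg.relIdxU hgen hBG b q)).base :=
    @Scheme.Hom.isEmbedding _ _ (locι hc hRa hν h0 b (Seg.relIdxU hgen hBG b q))
      ((upTower hc hRa hν h0 b).isPreimmersion_bcι (((upTower hc hRa hν h0 b).X 0).fromSpecStalk ((c b).pt : (upTower hc hRa hν h0 b).X 0)) _)
  have hNeq := nearLocus_unitTowerU hc hRa hν h0 hgen hBG hemp q (N := N)
  have hirrT : IsIrreducible ((unitTowerU hc hRa hν h0 hgen hBG b hemp).nearLocus N (basePt hc hRa hν h0 b) q) := by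
    rw [hNeq]; exact isIrreducible_preimage_of_isEmbedding hemb hirr hrange
  have hinfT : ((unitTowerU hc hRa hν h0 hgen hBG b hemp).nearLocus N (basePt hc hRa hν h0 b) q).Infinite := by
    rw [hNeq]
    intro hfin
    exact hinf ((Set.image_preimage_eq_of_subset hrange) ▸ hfin.image _)
  have hclT : IsClosed ((unitTowerU hc hRa hν h0 hgen hBG b hemp).nearLocus N (basePt hc hRa hν h0 b) q) := by
    rw [hNeq]; exact (isClosed_nearLocus hc hRa hν h0 hX hreach b _).preimage (locι hc hRa hν h0 b _).continuous
  exact not_isolated_of_isIrreducible_infinite hclT hirrT hinfT hscl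

include hRf hX hreach h314f hPb h314 h314pt in
/-- **Def. 6.38 (iv) ON THE UNIT TOWER FROM THE PRINTED FACTS keyed on `F`** (twin of `Seg.inducesIsoOn_unitTowerU_of_printedFacts`): `π_{j+1} : C_{j+1} ⥲ C_j` for `1 ≤ j`, `j + 1 < unitLen` (stub-2's
`inducesIsoOn_of_unit`, fed with (ii)′, (iii), a closed non-isolated near point inside the unit). [cite: CossartJannsenSaito2020, Def. 6.38 (iv), Lemma 6.33] -/
theorem inducesIsoOn_unitTowerU_of_printedFactsF (h36 : CossartJannsenSaito2020_thm_3_6.{0}) (h3104 : CossartJannsenSaito2020_thm_3_10_4.{0})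
    (b : ℕ) (hb : (c b).IsBlownUp R N ν) (hiso : Iso N (c b))
    (hF : ∀ n, ∀ y ∈ (locTower hc hRa hν h0 b).nearLocus N (basePt hc hRa hν h0 b) n,
      @F ((locTower hc hRa hν h0 b).X n) ((locTower hc hRa hν h0 b).ln n) y)
    (h22 : ∀ n, Iso N (c n) → dirDim (c n) = 2 ∧ (c n).geomDirDim = 2) (hemp : HEmpU hc hRa hν h0 hgen hBG b) :
    ∀ j : ℕ, 1 ≤ j → j + 1 < unitLen hgen hBG b →
      InducesIsoOn ((unitTowerU hc hRa hν h0 hgen hBG b hemp).π j) ((unitTowerU hc hRa hν h0 hgen hBG b hemp).C (j + 1))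
        ((unitTowerU hc hRa hν h0 hgen hBG b hemp).isClosed_C (j + 1)) ((unitTowerU hc hRa hν h0 hgen hBG b hemp).C j)
        ((unitTowerU hc hRa hν h0 hgen hBG b hemp).isClosed_C j) := by
  intro j hj hj1
  haveI : IsLocallyNoetherian ((upTower hc hRa hν h0 b).X 0) := (upTower hc hRa hν h0 b).ln 0
  haveI : IsLocallyNoetherian (c b).W := (c b).ln
  haveI hNoe : IsNoetherian ((unitTowerU hc hRa hν h0 hgen hBG b hemp).X 0) := by
    show IsNoetherian (Spec ((c b).W.presheaf.stalk (c b).pt)); infer_instance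
  obtain ⟨k', _, _, hg⟩ := hX.exists_stateGood_of_reaches hRa hν (reaches_chain hreach hc b)
  have hU := stratumIsolated_of_iso hg hiso
  have he := (h22 b hiso).1
  have hē := (h22 b hiso).2.le
  have hkey := keySetting_unitTowerU hc hRa hν h0 hgen hBG b hemp (N := N)
  have hperm := isPermissible_centreIdeal_unitTowerU hc hRa hν h0 hgen hBG b hemp (N := N)
  have hcl := isClosed_hsStratumGE_unitTowerU hc hRa hν h0 hgen hBG hemp (N := N)
  have hx : IsClosed ({basePt hc hRa hν h0 b} : Set ((unitTowerU hc hRa hν h0 hgen hBG b hemp).X 0)) := isClosed_singleton_closedPoint _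
  have hFT : ∀ i, ∀ y ∈ (unitTowerU hc hRa hν h0 hgen hBG b hemp).nearLocus N (basePt hc hRa hν h0 b) i,
      @F ((unitTowerU hc hRa hν h0 hgen hBG b hemp).X i) ((unitTowerU hc hRa hν h0 hgen hBG b hemp).ln i) y := fun i y hy =>
    hF (Seg.relIdxU hgen hBG b i) y
      (((locTower hc hRa hν h0 b).nearLocus_compress_zero (htriv_of_hEmpU hc hRa hν h0 hgen hBG hemp) N (basePt hc hRa hν h0 b) i) ▸ hy)
  have heT : (unitTowerU hc hRa hν h0 hgen hBG b hemp).dirDimAt 0 (basePt hc hRa hν h0 b) = 2 :=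
    (dirDimAt_unitTowerU_zero hc hRa hν h0 hgen hBG b hemp).trans he
  have hēT : (unitTowerU hc hRa hν h0 hgen hBG b hemp).geomDirDimAt 0 (basePt hc hRa hν h0 b) ≤ 2 :=
    (geomDirDimAt_unitTowerU_zero hc hRa hν h0 hgen hBG b hemp).trans_le hē
  have hC0 := unitTowerU_C_zero hc hRa hν h0 hgen hBG hRf hX b hemp (reaches_chain hreach hc b) hb hU
  have hDR := dich_regN_of_printedFactsF hc hRf hRa hν h0 hgen hBG hX hreach F h314f hPb h314 h314pt h36 h3104 b hb hiso hF he hē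
  have hC1 := unitTowerU_C_one_eq_projDirF hc hRf hRa hν h0 hgen hBG hX hreach F h314pt b hb hiso hF h22 hDR.1 hDR.2 hemp (by omega)
  obtain ⟨s1, hs1, -⟩ := exists_nearPt_unitTowerU hc hRa hν h0 hgen hBG hX hreach hemp 1
  have hCq : ∀ i, 2 ≤ i → i ≤ unitLen hgen hBG b - 1 →
      (unitTowerU hc hRa hν h0 hgen hBG b hemp).C i = (unitTowerU hc hRa hν h0 hgen hBG b hemp).nearLocus N (basePt hc hRa hν h0 b) i :=
    fun i _ hi => unitTowerU_C_eq_nearLocus hc hRf hRa hν h0 hgen hBG hX hreach b hb hiso hDR.1 hDR.2 hemp (by omega)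
  have hniso : ∀ i, 2 ≤ i → i ≤ unitLen hgen hBG b - 1 →
      ∃ z ∈ (unitTowerU hc hRa hν h0 hgen hBG b hemp).nearLocus N (basePt hc hRa hν h0 b) i,
        IsClosed ({z} : Set ((unitTowerU hc hRa hν h0 hgen hBG b hemp).X i)) ∧
        ¬ ∃ U : Set ((unitTowerU hc hRa hν h0 hgen hBG b hemp).X i), IsOpen U ∧
          U ∩ (unitTowerU hc hRa hν h0 hgen hBG b hemp).nearLocus N (basePt hc hRa hν h0 b) i = {z} :=
    fun i hi2 hi => exists_nearPt_not_isolated_unitTowerUF hc hRf hRa hν h0 hgen hBG hX hreach F h314f hPb h314 h314pt h36 h3104 b hb hiso hF he hē hemp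
      (by omega) (by omega)
  exact BlowupTowerNearW.inducesIsoOn_of_unit (T := unitTowerU hc hRa hν h0 hgen hBG b hemp) F h314f hPb h314 h314pt h36 h3104 hkey hperm hcl hx hFT
    heT hēT hC0 hC1 ⟨s1, hs1⟩ hCq hniso j hj (by omega)

include hRf hX hreach h314f hPb h314 h314pt in
/-- **Def. 6.38 (v) ON THE UNIT TOWER FROM THE PRINTED FACTS keyed on `F`** (twin of `Seg.not_subset_image_unitTowerU_of_printedFacts`): at the end of the unit (`unitLen = j + 1`, `1 ≤ j`) the blow-down does NOT map
`N_{j+1}` onto `C_j` (stub-2's `not_surjective_of_unit`, the marked point at the terminal `Iso` stage being closed and isolated in its near locus).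
[cite: CossartJannsenSaito2020, Def. 6.38 (v)–(vi)] -/
theorem not_subset_image_unitTowerU_of_printedFactsF (h36 : CossartJannsenSaito2020_thm_3_6.{0}) (h3104 : CossartJannsenSaito2020_thm_3_10_4.{0})
    (b : ℕ) (hb : (c b).IsBlownUp R N ν) (hiso : Iso N (c b))
    (hF : ∀ n, ∀ y ∈ (locTower hc hRa hν h0 b).nearLocus N (basePt hc hRa hν h0 b) n,
      @F ((locTower hc hRa hν h0 b).X n) ((locTower hc hRa hν h0 b).ln n) y)
    (h22 : ∀ n, Iso N (c n) → dirDim (c n) = 2 ∧ (c n).geomDirDim = 2) (hemp : HEmpU hc hRa hν h0 hgen hBG b) :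
    ∀ j : ℕ, 1 ≤ j → unitLen hgen hBG b = j + 1 →
      ¬ ((unitTowerU hc hRa hν h0 hgen hBG b hemp).C j ⊆ ((unitTowerU hc hRa hν h0 hgen hBG b hemp).π j).base ''
        (unitTowerU hc hRa hν h0 hgen hBG b hemp).nearLocus N (basePt hc hRa hν h0 b) (j + 1)) := by
  intro j hj hlen
  haveI : IsLocallyNoetherian ((upTower hc hRa hν h0 b).X 0) := (upTower hc hRa hν h0 b).ln 0
  haveI : IsLocallyNoetherian (c b).W := (c b).ln
  haveI hNoe : IsNoetherian ((unitTowerU hc hRa hν h0 hgen hBG b hemp).X 0) := by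
    show IsNoetherian (Spec ((c b).W.presheaf.stalk (c b).pt)); infer_instance
  obtain ⟨k', _, _, hg⟩ := hX.exists_stateGood_of_reaches hRa hν (reaches_chain hreach hc b)
  have hU := stratumIsolated_of_iso hg hiso
  have he := (h22 b hiso).1
  have hē := (h22 b hiso).2.le
  have hkey := keySetting_unitTowerU hc hRa hν h0 hgen hBG b hemp (N := N)
  have hperm := isPermissible_centreIdeal_unitTowerU hc hRa hν h0 hgen hBG b hemp (N := N)
  have hcl := isClosed_hsStratumGE_unitTowerU hc hRa hν h0 hgen hBG hemp (N := N)
  have hx : IsClosed ({basePt hc hRa hν h0 b} : Set ((unitTowerU hc hRa hν h0 hgen hBG b hemp).X 0)) := isClosed_singleton_closedPoint _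
  have hFT : ∀ i, ∀ y ∈ (unitTowerU hc hRa hν h0 hgen hBG b hemp).nearLocus N (basePt hc hRa hν h0 b) i,
      @F ((unitTowerU hc hRa hν h0 hgen hBG b hemp).X i) ((unitTowerU hc hRa hν h0 hgen hBG b hemp).ln i) y := fun i y hy =>
    hF (Seg.relIdxU hgen hBG b i) y
      (((locTower hc hRa hν h0 b).nearLocus_compress_zero (htriv_of_hEmpU hc hRa hν h0 hgen hBG hemp) N (basePt hc hRa hν h0 b) i) ▸ hy)
  have heT : (unitTowerU hc hRa hν h0 hgen hBG b hemp).dirDimAt 0 (basePt hc hRa hν h0 b) = 2 :=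
    (dirDimAt_unitTowerU_zero hc hRa hν h0 hgen hBG b hemp).trans he
  have hēT : (unitTowerU hc hRa hν h0 hgen hBG b hemp).geomDirDimAt 0 (basePt hc hRa hν h0 b) ≤ 2 :=
    (geomDirDimAt_unitTowerU_zero hc hRa hν h0 hgen hBG b hemp).trans_le hē
  have hC0 := unitTowerU_C_zero hc hRa hν h0 hgen hBG hRf hX b hemp (reaches_chain hreach hc b) hb hU
  have hDR := dich_regN_of_printedFactsF hc hRf hRa hν h0 hgen hBG hX hreach F h314f hPb h314 h314pt h36 h3104 b hb hiso hF he hē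
  have hC1 := unitTowerU_C_one_eq_projDirF hc hRf hRa hν h0 hgen hBG hX hreach F h314pt b hb hiso hF h22 hDR.1 hDR.2 hemp (by omega)
  obtain ⟨s1, hs1, -⟩ := exists_nearPt_unitTowerU hc hRa hν h0 hgen hBG hX hreach hemp 1
  have hCq : ∀ i, 2 ≤ i → i ≤ j →
      (unitTowerU hc hRa hν h0 hgen hBG b hemp).C i = (unitTowerU hc hRa hν h0 hgen hBG b hemp).nearLocus N (basePt hc hRa hν h0 b) i :=
    fun i _ hi => unitTowerU_C_eq_nearLocus hc hRf hRa hν h0 hgen hBG hX hreach b hb hiso hDR.1 hDR.2 hemp (by omega)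
  have hniso : ∀ i, 2 ≤ i → i ≤ j →
      ∃ z ∈ (unitTowerU hc hRa hν h0 hgen hBG b hemp).nearLocus N (basePt hc hRa hν h0 b) i,
        IsClosed ({z} : Set ((unitTowerU hc hRa hν h0 hgen hBG b hemp).X i)) ∧
        ¬ ∃ U : Set ((unitTowerU hc hRa hν h0 hgen hBG b hemp).X i), IsOpen U ∧
          U ∩ (unitTowerU hc hRa hν h0 hgen hBG b hemp).nearLocus N (basePt hc hRa hν h0 b) i = {z} :=
    fun i hi2 hi => exists_nearPt_not_isolated_unitTowerUF hc hRf hRa hν h0 hgen hBG hX hreach F h314f hPb h314 h314pt h36 h3104 b hb hiso hF he hē hemp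
      (by omega) (by omega)
  have key : ∀ m, m = unitLen hgen hBG b →
      ∃ s ∈ (unitTowerU hc hRa hν h0 hgen hBG b hemp).nearLocus N (basePt hc hRa hν h0 b) m,
        IsClosed ({s} : Set ((unitTowerU hc hRa hν h0 hgen hBG b hemp).X m)) ∧
        ∃ U : Set ((unitTowerU hc hRa hν h0 hgen hBG b hemp).X m), IsOpen U ∧
          U ∩ (unitTowerU hc hRa hν h0 hgen hBG b hemp).nearLocus N (basePt hc hRa hν h0 b) m = {s} := by
    rintro m rfl
    exact exists_isolated_nearPt_unitTowerU_terminal hc hRa hν h0 hgen hBG hX hreach hemp (N := N)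
  obtain ⟨z, -, hzcl, hisoz⟩ := key (j + 1) hlen.symm
  exact BlowupTowerNearW.not_surjective_of_unit (T := unitTowerU hc hRa hν h0 hgen hBG b hemp) F h314f h314pt h36 h3104 hkey hperm hcl hx hFT
    heT hēT hC0 hC1 ⟨s1, hs1⟩ hj hCq hniso hzcl hisoz

end AssemblyBF

/-! ## §2. The pure-geometry row from the geometric-directrix forms of the printed facts: every `p`, every regime `Q` -/

/-- **`F := GeomDirHypothesis` HOLDS ALONG THE NEAR LOCI OF THE LOCALISED TOWER `locTower b` at level `N = 3` when `ē(x_b) ≤ 2`** (stub-2's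
`BlowupTowerNearGeomDir.geomDirHypothesis_of_mem_nearLocus` on `locTower b`: `dim Spec 𝒪_{X_b,x_b} ≤ 3` from `KeySetting`, `ē` at the closed point of
the local scheme `=` `ē(x_b)`). [cite: CossartJannsenSaito2020, Thm. 3.14, Lemma 6.33 (1)] -/
theorem geomDirHypothesis_nearLocus_locTower {R : ∀ S : Scheme.{0}, CentreSeq S → Prop} {ν : ℕ → ℕ} {k : Type} [Field k]
    {c : ℕ → MarkedStage.{0}} (hc : ∀ n, CanonicalNearStep R 3 ν (c n) (c (n + 1))) (hRa : OracleAdmissible R)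
    (hν : ν ≠ iterPSum 3 Phi) (h0 : Helpers.CycleInv k 3 ν (c 0)) (h3104 : CossartJannsenSaito2020_thm_3_10_4.{0}) (b : ℕ)
    (hē : (c b).geomDirDim ≤ 2) :
    ∀ n, ∀ y ∈ (locTower hc hRa hν h0 b).nearLocus 3 (basePt hc hRa hν h0 b) n,
      @GeomDirHypothesis ((locTower hc hRa hν h0 b).X n) ((locTower hc hRa hν h0 b).ln n) y := by
  haveI : IsLocallyNoetherian ((upTower hc hRa hν h0 b).X 0) := (upTower hc hRa hν h0 b).ln 0
  haveI : IsLocallyNoetherian (c b).W := (c b).ln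
  have hkey : KeySetting (locTower hc hRa hν h0 b) 3 :=
    (upTower hc hRa hν h0 b).keySetting_localize (c b).pt 3 (keySetting_upTower hc hRa hν h0 b)
  have hperm : ∀ q, IdealSheafData.IsPermissible ((locTower hc hRa hν h0 b).centreIdeal q) := fun q =>
    (upTower hc hRa hν h0 b).isPermissible_centreIdeal_localize (c b).pt _ (isPermissible_centreIdeal_upTower hc hRa hν h0 b _)
  have hēT : (locTower hc hRa hν h0 b).geomDirDimAt 0 (basePt hc hRa hν h0 b) ≤ 2 := by
    have : (locTower hc hRa hν h0 b).geomDirDimAt 0 (basePt hc hRa hν h0 b) = (c b).geomDirDim :=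
      Scheme.geomDirDim_fromSpecStalk_closedPoint (c b).W (c b).pt
    rw [this]; exact hē
  exact BlowupTowerNearGeomDir.geomDirHypothesis_of_mem_nearLocus (locTower hc hRa hν h0 b) h3104 hkey hperm hkey.dim_le hēT

/-- **THE PURE-GEOMETRY ROW `Seg.UnitGeometryAtQM p Q` FOR EVERY `p` AND EVERY REGIME `Q`, FROM THE GEOMETRIC-DIRECTRIX FORMS OF THE PRINTED
FACTS** ((Dich)/(RegN): Step A keyed on `F := GeomDirHypothesis`; (ii)′: `Seg.unitTowerU_C_one_eq_projDirF`; (iv), (v): §1; `F` along the near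
loci from `ē ≤ 2` along the chain). The β row (`p = 2`, `Q = ⊤`) of the census is the instance `unitGeometryAtQM_of_geomDirFacts 2 ⊤ …`.
[cite: CossartJannsenSaito2020, Thm. 3.14, Lemma 6.33, Def. 6.34, Def. 6.38] -/
theorem unitGeometryAtQM_of_geomDirFacts (p : ℕ) (Q : ℕ → (ℕ → ℕ) → ∀ X : Scheme.{0}, X → Prop)
    (hF314 : Theorem314_geomDir.{0}) (hFf : Theorem314_nearFibre_geomDir.{0}) (h314gd : Thm314_point_locus_geomDir.{0})
    (h36 : CossartJannsenSaito2020_thm_3_6.{0}) (h3104 : CossartJannsenSaito2020_thm_3_10_4.{0}) :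
    UnitGeometryAtQM p Q := by
  intro R hRf hRa ν X _ x hX _ c hreach hc hēall hgen hIso h22 k _ h0 hν hBG b hb hiso
  have hF := geomDirHypothesis_nearLocus_locTower hc hRa hν h0 h3104 b (hēall b)
  have hPb := Moving.isIso_residueFieldMap_of_near_of_geomDirHypothesis.{0} h314gd
  have h314 := BlowupTowerNearGeomDir.theorem314_geomDir_binder.{0} hF314
  have hDR := dich_regN_of_printedFactsF hc hRf hRa hν h0 hgen hBG hX hreach (fun X _ x => GeomDirHypothesis X x) hFf hPb h314 h314gd h36 h3104
    b hb hiso hF (h22 b hiso).1 (h22 b hiso).2.le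
  refine ⟨hDR.1, hDR.2, fun h2 => ?_, ?_, ?_⟩
  · exact unitTowerU_C_one_eq_projDirF hc hRf hRa hν h0 hgen hBG hX hreach (fun X _ x => GeomDirHypothesis X x) h314gd b hb hiso hF h22 hDR.1
      hDR.2 _ h2
  · exact inducesIsoOn_unitTowerU_of_printedFactsF hc hRf hRa hν h0 hgen hBG hX hreach (fun X _ x => GeomDirHypothesis X x) hFf hPb h314 h314gd
      h36 h3104 b hb hiso hF h22 _
  · exact not_subset_image_unitTowerU_of_printedFactsF hc hRf hRa hν h0 hgen hBG hX hreach (fun X _ x => GeomDirHypothesis X x) hFf hPb h314 h314gd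
      h36 h3104 b hb hiso hF h22 _

/-- **THE RECOGNITION ROW `UnitRecognitionAtQMU p Q` FOR EVERY `p` AND EVERY REGIME `Q`** from the geometric-directrix forms of the printed facts
(`unitRecognitionAtQMU_of_geometry`, res-L1-w42-stub-1). [cite: CossartJannsenSaito2020, Def. 6.38] -/
theorem unitRecognitionAtQMU_of_geomDirFacts (p : ℕ) (Q : ℕ → (ℕ → ℕ) → ∀ X : Scheme.{0}, X → Prop)
    (hF314 : Theorem314_geomDir.{0}) (hFf : Theorem314_nearFibre_geomDir.{0}) (h314gd : Thm314_point_locus_geomDir.{0})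
    (h36 : CossartJannsenSaito2020_thm_3_6.{0}) (h3104 : CossartJannsenSaito2020_thm_3_10_4.{0}) :
    UnitRecognitionAtQMU p Q :=
  unitRecognitionAtQMU_of_geometry p Q (unitGeometryAtQM_of_geomDirFacts p Q hF314 hFf h314gd h36 h3104)

/-- **THE CHARACTERISTIC-FREE UNITS-HALF EXTRACTION `UnitTowerExtractionLocFreeM p` FOR EVERY `p`, FROM THE GEOMETRIC-DIRECTRIX FORMS OF THE
PRINTED FACTS** — the `hext`/`hrec` input of the β row's census (`wlow3TwoM_census_printedFacts` binds `hrec : Seg.UnitRecognitionAtQM 2 ⊤` and feeds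
`unitTowerExtractionLocFreeM_of_recognition hrec`; this term replaces it, with binders already in that census), via res-L1-w42-stub-1's
`unitTowerExtractionLocFree_of_recognitionU` at `Q = ⊤`. [cite: CossartJannsenSaito2020, Def. 6.38, Def. 6.39, Thm. 6.40, p. 107] -/
theorem unitTowerExtractionLocFreeM_of_geomDirFacts (p : ℕ)
    (hF314 : Theorem314_geomDir.{0}) (hFf : Theorem314_nearFibre_geomDir.{0}) (h314gd : Thm314_point_locus_geomDir.{0})
    (h36 : CossartJannsenSaito2020_thm_3_6.{0}) (h3104 : CossartJannsenSaito2020_thm_3_10_4.{0}) :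
    UnitTowerExtractionLocFreeM p :=
  fun R hRf hRa ν X _ x hX c h0 hstep hG hmov hIso h22 =>
    unitTowerExtractionLocFree_of_recognitionU p _
      (unitRecognitionAtQMU_of_geomDirFacts p (fun _ _ _ _ => True) hF314 hFf h314gd h36 h3104)
      R hRf hRa ν X x hX trivial c h0 hstep hG hmov hIso h22

end Summit.ResolutionOfSingularities.ResolutionOfSingularities.Theorems.SigmaMaxModificationsCorridor3.Moving.Seg

end
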